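import Summits.BirchSwinnertonDyer.Rank1Residual.X5.SelmerSolitaireCoveredMove
import Summits.BirchSwinnertonDyer.Rank1Residual.X5.SelmerSolitaireExtends
import Summits.BirchSwinnertonDyer.Rank1Residual.X5.SelmerSolitaireBad1Prime
import HarnessLib

/-!
# Selmer solitaire: T4′ `Bad1ThreePrimeConnection'` (BAD₁ closure in three admissible moves) — PROVED

Cell `b2b-bsdres`, O1 (p = 2) PROVER ORDER v2.8 (ii′) (x11b3-p4, R-G18.3 owner; spelling of record
R-G18.2 ≡ lens-2 2G9.8 (d), `X5/SelmerSolitaireBad1Prime.lean`).  Pure 𝔽₂ linear algebra / cube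
combinatorics; theorems only; reach-neutral — R1 ("`𝒳⁰` connected at 2") closes NO class by itself;
nothing arithmetic asserted (the dictionary stub₁′ to Kolyvagin primes is NOT in the tree); nothing
booked; no mark; O1 OPEN.  HONEST FRAMING (cell, verbatim): research route.

**Theorem** `bad1ThreePrimeConnection'_holds : Bad1ThreePrimeConnection'`.  Proof (plan
`HOME/b2b-bsdres-x11b3-p4/T4PRIME-PLAN.md`, simplified): let `(A, ε₀)` be a consistent non-degenerate
decoration and `B` core.
* COVERED (`A ⊄ B`, or `A = ∅`): one covered move (`exists_admissible_connected_of_cover`) + two dummies.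
* ROOT (`B = A ≠ ∅`): one REBASED move at `C = A` (`exists_admissible_connected_rebase`; the re-based
  decoration is `(∅, 1)` by `rebase_eps_eq_one_of_root`) + two dummies.
* UNCOVERED (`∅ ≠ A ⊊ B`): pick `a ∈ A`, `b ∈ B ∖ A`; MOVE 1 = the explicit admissible move `q₁ ∼ {a, b}`
  (then `C₁ = {b, q₁}` is core); MOVE 2 = covered move `∅ → C₁` (`a ∈ A ∖ C₁`); MOVE 3 = rebased move at
  `C₂ = lift C₁` towards `lift² B` (`b ∈ (A ∆ C₂) ∖ (B ∆ C₂)`); compose the paths (monotonicity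
  `connected_lift`, transport `connected_pivotPos_iff`).
Inputs: x11b3-p2 GEN 5's strong T4 `exists_extend_chain`, `extend`, locality `core_extend_update_iff`;
x11b3-p4's PPT kit (`pivotPos`, (R2) `pivotPos_extend`, (R3) `admissible_transport`,
`bad1Consistent_pivotPos`), monotonicity (`core_lift_iff`, `connected_lift`,
`bad1Consistent_lift_of_admissibleExtends`).

References: lens-2 GEN 5/9, ROUTES-O1 §lens-2 G5.3, G5.9, 2G9.8; B. Mazur, K. Rubin, *Kolyvagin
systems* (2004) §4.3. [cite: MazurRubin2004, §4.3] [cite: Tsatsomeros2000, Thm. 3.1]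
-/

namespace Summit.BirchSwinnertonDyer.Rank1Residual.X5.SelmerSolitaire

open Finset Matrix

variable {s : ℕ}

/-- Non-degeneracy lifts. [folklore] -/
theorem lift_nonempty_or {A : Finset (Fin s)} {ε₀ : ZMod 2} (h : A.Nonempty ∨ ε₀ = 1) :
    (lift A).Nonempty ∨ ε₀ = 1 := by
  rcases h with ⟨a, ha⟩ | h
  · exact Or.inl ⟨a.castSucc, (castSucc_mem_lift_iff A a).mpr ha⟩
  · exact Or.inr h

/-- **Padding by two dummy admissible moves** (connectivity persists by monotonicity).
[cite: MazurRubin2004, §4.3] -/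
theorem exists_two_dummies (P₁ : Position (s + 1)) {A : Finset (Fin s)} {ε₀ : ZMod 2}
    (hne : A.Nonempty ∨ ε₀ = 1) {B₁ : Finset (Fin (s + 1))} (hconn : Connected P₁ ∅ B₁) :
    ∃ (P₂ : Position (s + 2)) (P₃ : Position (s + 3)),
      AdmissibleExtends P₁ (lift A) ε₀ P₂ ∧ AdmissibleExtends P₂ (lift (lift A)) ε₀ P₃ ∧
        Connected P₃ ∅ (lift (lift B₁)) := by
  obtain ⟨N₂, h₂⟩ := exists_admissibleExtends P₁ (lift_nonempty_or hne)
  obtain ⟨N₃, h₃⟩ := exists_admissibleExtends (extend P₁ N₂) (lift_nonempty_or (lift_nonempty_or hne))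
  refine ⟨_, _, h₂, h₃, ?_⟩
  have h := connected_lift (extend_extends _ N₃) (connected_lift (extend_extends P₁ N₂) hconn)
  rwa [lift_empty, lift_empty] at h

/-- **T4′ (BAD₁ CLOSURE), repaired form, HOLDS.** [cite: MazurRubin2004, §4.3] -/
theorem bad1ThreePrimeConnection'_holds : Bad1ThreePrimeConnection' := by
  classical
  intro s P A ε₀ hne B hc hB
  by_cases h1 : ¬ A ⊆ B ∨ A = ∅
  · -- COVERED: one covered move + two dummies
    have hcov : ¬ A ⊆ B ∨ (A = ∅ ∧ ε₀ = 1) := by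
      rcases h1 with h | h
      · exact Or.inl h
      · refine Or.inr ⟨h, ?_⟩
        rcases hne with hA | hε
        · exact absurd h hA.ne_empty
        · exact hε
    obtain ⟨N₁, hadm₁, hconn₁⟩ := exists_admissible_connected_of_cover P hB hcov
    obtain ⟨P₂, P₃, h₂, h₃, h⟩ := exists_two_dummies (extend P N₁) hne hconn₁
    exact ⟨_, P₂, P₃, hadm₁, h₂, h₃, h⟩
  · obtain ⟨hAB, hA⟩ := not_or.mp h1
    have hAB : A ⊆ B := not_not.mp hAB
    have hAne : A.Nonempty := Finset.nonempty_iff_ne_empty.mpr hA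
    by_cases hBA : B = A
    · -- ROOT: one rebased move at `C = A` + two dummies
      have hA' : Core P A := by rw [← hBA]; exact hB
      have hAA : symmDiff A A = (∅ : Finset (Fin s)) := by rw [symmDiff_self, Finset.bot_eq_empty]
      have hcovR : ¬ symmDiff A A ⊆ A ∨ (symmDiff A A = ∅ ∧
          (if Even A.card then ε₀ else ∑ a ∈ A, P.S none (some a)) = 1) :=
        Or.inr ⟨hAA, rebase_eps_eq_one_of_root P hc hA' hAne⟩
      have hm : Core P (symmDiff A A) := by rw [hAA]; exact core_empty P
      obtain ⟨N₁, hadm₁, hconn₁⟩ := exists_admissible_connected_rebase P hc A hA' A hm hcovR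
      rw [symmDiff_self, Finset.bot_eq_empty] at hconn₁
      have hconn₁' : Connected (extend P N₁) ∅ (lift B) := by rw [hBA]; exact connected_symm hconn₁
      obtain ⟨P₂, P₃, h₂, h₃, h⟩ := exists_two_dummies (extend P N₁) hne hconn₁'
      exact ⟨_, P₂, P₃, hadm₁, h₂, h₃, h⟩
    · -- UNCOVERED: explicit move, covered move, rebased move
      obtain ⟨b, hbB, hbA⟩ : ∃ b ∈ B, b ∉ A :=
        Finset.not_subset.mp fun h => hBA (Finset.Subset.antisymm h hAB)
      obtain ⟨a, haA⟩ := hAne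
      have hab : a ≠ b := fun h => hbA (h ▸ haA)
      -- MOVE 1: `q₁ ∼ {a, b}`
      set N₁ : V s → ZMod 2 := Pi.single (some b) 1 + Pi.single (some a) 1 with hN₁
      have hba' : (some b : V s) ≠ some a := fun h => hab (Option.some_injective _ h).symm
      have hN₁b : N₁ (some b) = 1 := by
        rw [hN₁, Pi.add_apply, Pi.single_eq_same, Pi.single_eq_of_ne hba', add_zero]
      have hadm₁ : AdmissibleExtends P A ε₀ (extend P N₁) := by
        rw [admissibleExtends_extend_iff, hN₁, add_dotProduct, single_dotProduct, single_dotProduct,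
          decVec_some, decVec_some, if_neg hbA, if_pos haA, mul_zero, one_mul, zero_add]
      set P₁ := extend P N₁ with hP₁
      have hc₁ : Bad1Consistent P₁ (lift A) ε₀ := bad1Consistent_lift_of_admissibleExtends hc hadm₁
      have hC₁ : Core P₁ (withNew {b}) := core_withNew_singleton P N₁ hN₁b
      -- MOVE 2: covered move `∅ → C₁ = {b, q₁}` (covered by `a`)
      have hcov₁ : ¬ lift A ⊆ withNew {b} ∨ (lift A = ∅ ∧ ε₀ = 1) := by
        left
        intro h
        have ha1 : a.castSucc ∈ withNew ({b} : Finset (Fin s)) := h ((castSucc_mem_lift_iff A a).mpr haA)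
        have hab' : a ∉ ({b} : Finset (Fin s)) := by rwa [Finset.mem_singleton]
        exact castSucc_not_mem_withNew hab' ha1
      obtain ⟨N₂, hadm₂, hconn₂⟩ := exists_admissible_connected_of_cover P₁ hC₁ hcov₁
      set P₂ := extend P₁ N₂ with hP₂
      have hc₂ : Bad1Consistent P₂ (lift (lift A)) ε₀ := bad1Consistent_lift_of_admissibleExtends hc₁ hadm₂
      -- MOVE 3: rebased move at `C₂ = lift C₁` towards `B₂ = lift² B` (covered by `b`)
      set C₂ : Finset (Fin (s + 2)) := lift (withNew {b}) with hC₂def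
      set B₂ : Finset (Fin (s + 2)) := lift (lift B) with hB₂def
      have hC₂ : Core P₂ C₂ := (core_extend_lift_iff P₁ N₂ (withNew {b})).mpr hC₁
      have hB₂ : Core P₂ B₂ :=
        (core_extend_lift_iff P₁ N₂ (lift B)).mpr ((core_extend_lift_iff P N₁ B).mpr hB)
      have hm : Core P₂ (symmDiff (symmDiff B₂ C₂) C₂) := by rwa [symmDiff_symmDiff_cancel_right]
      set x : Fin (s + 2) := b.castSucc.castSucc with hx
      have hxA : x ∉ lift (lift A) := by
        rw [hx, castSucc_mem_lift_iff, castSucc_mem_lift_iff]; exact hbA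
      have hxC : x ∈ C₂ := by
        rw [hC₂def, hx, castSucc_mem_lift_iff]
        unfold withNew
        rw [Finset.mem_insert, castSucc_mem_lift_iff, Finset.mem_singleton]
        exact Or.inr rfl
      have hxB : x ∈ B₂ := by
        rw [hB₂def, hx, castSucc_mem_lift_iff, castSucc_mem_lift_iff]; exact hbB
      have hcov₂ : ¬ symmDiff (lift (lift A)) C₂ ⊆ symmDiff B₂ C₂ ∨
          (symmDiff (lift (lift A)) C₂ = ∅ ∧
            (if Even C₂.card then ε₀ else ∑ a ∈ lift (lift A), P₂.S none (some a)) = 1) := by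
        left
        intro h
        have h1 : x ∈ symmDiff (lift (lift A)) C₂ := Finset.mem_symmDiff.mpr (Or.inr ⟨hxC, hxA⟩)
        rcases Finset.mem_symmDiff.mp (h h1) with ⟨_, h3⟩ | ⟨_, h3⟩
        · exact h3 hxC
        · exact h3 hxB
      obtain ⟨N₃, hadm₃, hconn₃⟩ :=
        exists_admissible_connected_rebase P₂ hc₂ C₂ hC₂ (symmDiff B₂ C₂) hm hcov₂
      rw [lift_symmDiff, symmDiff_symmDiff_cancel_right] at hconn₃
      refine ⟨P₁, P₂, extend P₂ N₃, hadm₁, hadm₂, hadm₃, ?_⟩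
      have h4 := connected_lift (extend_extends P₂ N₃) hconn₂
      rw [lift_empty] at h4
      exact connected_trans h4 hconn₃

end Summit.BirchSwinnertonDyer.Rank1Residual.X5.SelmerSolitaire
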